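/-
Copyright: the b2b-balaban T⁴-continuum CRUX team, row NE7b OWNER lineage `t4-ne7b-p1` (gen 139). Project licence.
-/
import Summits.QuantumFields.BalabanUV.T4Continuum.Spine.NE7b.SupOneSiteResampling
import Mathlib.MeasureTheory.Integral.Marginal
import Mathlib.MeasureTheory.Measure.Tilted

/-!
# THE ONE-SITE RESAMPLING OPERATOR IS INVARIANT AND LOSES AT MOST `a_xb_x∕c_x` OF COVARIANCE PER STEP (SCOPING (d10)(2), hypotheses
# (P2), (P3) of (442) in Lebesgue form): for the Gibbs weight `ρ = e^{−V}` on `ℝ^ι` and the operator `P_x` of (445),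
#   (P2) `∫(P_xF)ρ = ∫Fρ`,    (P3) `|∫FGρ − ∫(P_xF)(P_xG)ρ| ≤ (a_xb_x∕c_x)·∫ρ`
# for class members `F, G` with vectors `a, b`. Both rest on ONE transfer lemma — «two integrable functions on `ℝ^ι` whose integrals along
# every `x`-line agree have the same integral» (Mathlib's `lmarginal` of a singleton, split into positive and negative parts) — and on
# (443)'s one-site letters: along an `x`-line `P_xF` is the constant Gibbs mean, and the conditional covariance is at most `a_xb_x∕c_x`
# (row NE7b, node U5c; (441), (443), (445) BY NAME; Mathlib's `lmarginal_singleton`, `lintegral_eq_of_lmarginal_eq`; [folklore])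

Cell `pub-balaban`, sub-cell `t4`, spine estimate NE7b (`T4WeightBudget.RelWeightBound`; the cell's OWN estimate — NOT PRINTED in
[Bałaban 1983–89], NOT PROVED).  Crux-route work under `Spine/NE7b/` by the row OWNER (`t4-ne7b-p1` gen 139, file (446)) under FREEZE
(0)'s crux-prover clause; NOTHING of Bałaban's is named as a Lean object, valued or asserted; no `T4Continuum/Support` leaf typed; no
`def`, no notation; zero `sorry`.  Imports (BY NAME): the OWNER's (445) `…SupOneSiteResampling` (`resample_lipVec`, `resample_update_self`,
`line_hasDerivAt`, `line_obs_integrable`), (443) (`cov_raw_abs_le_floor`, `integrable_of_le_exp`, `lip_bound`, `lip_continuous`), (441)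
(`continuous`, `integrable`, `integrable_mul`); Mathlib's `Marginal`, `Measure.tilted`.

WHAT IS PROVED ([folklore]; `V`, `V₁`, floors `c`, ceiling `Cw`, cross letters `J`, operator `P` as in (445); `hV0 : e^{−V} ∈ L¹`,
`hV2 : ω_z²e^{−V} ∈ L¹`, `hVc : V` continuous):
* §1 **`integral_eq_of_line_integral_eq`** (the transfer lemma), `measurable_line_integral` (`ω ↦ ∫H(ω^{x,s})ds` is measurable for continuous `H`).
* §2 integrability against `ρ` (via the Gibbs probability law `volume.tilted (−V)` and (441)): `memLp_coord_tilted`,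
  `integrable_class_mul_exp`, `integrable_class_prod_mul_exp`, `line_prod_integrable`.
* §3 (P2) **`resample_integral`** (`∫(P_xF)ρ = ∫Fρ`).
* §4 (P3) `cond_cov_abs_le` (the conditional covariance along the `x`-line is `≤ a_xb_x∕c_x`), **`resample_cov_step`**
  (`|∫FGρ − ∫(P_xF)(P_xG)ρ| ≤ (a_xb_x∕c_x)∫ρ`; mind the parentheses: `(∫FGρ) − ∫…` in Lean).

HONEST (what this is NOT).  Lebesgue form; the normalisation to the Gibbs probability law, the assembly with (442) and the road instance are
(447)–(448).  Scalar skeleton ((A3), NC-NE7b-α UNRULED); nothing of Bałaban's asserted.  BY-NAME EFFECT ON THE WALL: NONE.  NE7b NOT PRINTED ∕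
NOT PROVED; spine PROVED 0∕9; rung (B)+1 — the programme's measures remain FINITE-torus statements; NOT the mass gap, NOT Clay.  HONEST
DEPENDENCY: continuum YM on T⁴ ⇐ BetaPertH ∧ nine spine estimates (0∕9 proved); BetaPertH ⇐ (D1) ∧ (D4) ∧ CAP+tail; G-an2-4 gates asym,
D1 and NE2∕3∕4.
-/

set_option autoImplicit false

noncomputable section

namespace Summit.QuantumFields.BalabanUV.T4Continuum.NE7b.SupOneSiteResamplingInvariance

open MeasureTheory Real Set Function Finset
open scoped BigOperators ENNReal
open SupOneSiteResampling (resample_lipVec resample_update_self line_hasDerivAt line_obs_integrable)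
open SupOneSiteGibbsLetters (cov_raw_abs_le_floor integrable_of_le_exp lip_bound lip_continuous)

variable {ι : Type} [Fintype ι] [DecidableEq ι]

variable {V : (ι → ℝ) → ℝ} {V₁ : ι → (ι → ℝ) → ℝ} {c : ι → ℝ} {Cw : ℝ} {J : ι → ι → ℝ}
  {P : ι → ((ι → ℝ) → ℝ) → ((ι → ℝ) → ℝ)} {F G : (ι → ℝ) → ℝ} {a b : ι → ℝ}

/-! ## §1. The transfer lemma: equal line integrals give equal integrals -/

/-- **TRANSFER**: two measurable integrable functions on `ℝ^ι` whose integrals along every `x`-line exist and agree have the same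
integral (Tonelli for the singleton marginal, applied to the positive and negative parts of the difference). [folklore] -/
theorem integral_eq_of_line_integral_eq (x : ι) {f g : (ι → ℝ) → ℝ} (hfm : Measurable f) (hgm : Measurable g) (hf : Integrable f)
    (hg : Integrable g) (h1 : ∀ ω, Integrable (fun s => f (update ω x s))) (h2 : ∀ ω, Integrable (fun s => g (update ω x s)))
    (heq : ∀ ω, ∫ s, f (update ω x s) = ∫ s, g (update ω x s)) : ∫ ω, f ω = ∫ ω, g ω := by
  -- the difference has vanishing line integrals
  have hdl : ∀ ω, Integrable (fun s => f (update ω x s) - g (update ω x s)) := fun ω => (h1 ω).sub (h2 ω)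
  have hd0 : ∀ ω, ∫ s, (f (update ω x s) - g (update ω x s)) = 0 := fun ω => by rw [integral_sub (h1 ω) (h2 ω), heq ω, sub_self]
  -- along every line the positive and the negative part have the same `lintegral`
  have hAB : ∀ ω, ∫⁻ s, ENNReal.ofReal (f (update ω x s) - g (update ω x s)) = ∫⁻ s, ENNReal.ofReal (-(f (update ω x s) - g (update ω x s))) := by
    intro ω
    have h := integral_eq_lintegral_pos_part_sub_lintegral_neg_part (hdl ω)
    rw [hd0 ω] at h
    have hA : ∫⁻ s, ENNReal.ofReal (f (update ω x s) - g (update ω x s)) ≠ ⊤ := (hdl ω).lintegral_lt_top.ne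
    have hB : ∫⁻ s, ENNReal.ofReal (-(f (update ω x s) - g (update ω x s))) ≠ ⊤ := (hdl ω).neg.lintegral_lt_top.ne
    exact (ENNReal.toReal_eq_toReal_iff' hA hB).1 (by linarith)
  -- hence the same integral over `ℝ^ι` (singleton marginal)
  have hΦp : Measurable fun ω : ι → ℝ => ENNReal.ofReal (f ω - g ω) := (hfm.sub hgm).ennreal_ofReal
  have hΦm : Measurable fun ω : ι → ℝ => ENNReal.ofReal (-(f ω - g ω)) := (hfm.sub hgm).neg.ennreal_ofReal
  have key : ∫⁻ ω, ENNReal.ofReal (f ω - g ω) ∂(Measure.pi fun _ : ι => (volume : Measure ℝ)) =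
      ∫⁻ ω, ENNReal.ofReal (-(f ω - g ω)) ∂(Measure.pi fun _ : ι => (volume : Measure ℝ)) := by
    refine lintegral_eq_of_lmarginal_eq {x} hΦp hΦm ?_
    rw [lmarginal_singleton, lmarginal_singleton]
    funext ω
    exact hAB ω
  have key' : ∫⁻ ω, ENNReal.ofReal (f ω - g ω) = ∫⁻ ω, ENNReal.ofReal (-(f ω - g ω)) := key
  have hfg : Integrable (fun ω => f ω - g ω) := hf.sub hg
  have hd := integral_eq_lintegral_pos_part_sub_lintegral_neg_part hfg
  rw [key', sub_self] at hd
  have := integral_sub hf hg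
  linarith

/-- **A line integral of a continuous integrand is measurable in the base point**: `ω ↦ ∫H(ω^{x,s})ds`. [folklore] -/
theorem measurable_line_integral (x : ι) {H : (ι → ℝ) → ℝ} (hH : Continuous H) :
    Measurable fun ω : ι → ℝ => ∫ s, H (update ω x s) := by
  have hc : Continuous fun p : (ι → ℝ) × ℝ => H (update p.1 x p.2) := hH.comp (continuous_update x)
  exact (hc.stronglyMeasurable.integral_prod_right' (ν := (volume : Measure ℝ))).measurable

/-! ## §2. Integrability against the Gibbs weight -/

omit [DecidableEq ι] in
/-- **Second moments of the coordinates under the Gibbs law** `ν = e^{−V}dω∕∫e^{−V}` (`volume.tilted (−V)`), from the letter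
`ω_z²e^{−V} ∈ L¹`. [folklore] -/
theorem memLp_coord_tilted (hV0 : Integrable (fun ω : ι → ℝ => exp (-V ω)))
    (hV2 : ∀ z, Integrable (fun ω : ι → ℝ => ω z ^ 2 * exp (-V ω))) (z : ι) :
    MemLp (fun ω : ι → ℝ => ω z) 2 ((volume : Measure (ι → ℝ)).tilted fun ω => -V ω) := by
  rw [memLp_two_iff_integrable_sq (measurable_pi_apply z).aestronglyMeasurable, integrable_tilted_iff hV0]
  refine (hV2 z).congr (ae_of_all _ fun ω => ?_)
  simp only [smul_eq_mul]; ring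

/-- **A class member is integrable against `ρ`**: `F·e^{−V} ∈ L¹` ((441) under the Gibbs law, transferred). [folklore] -/
theorem integrable_class_mul_exp (hV0 : Integrable (fun ω : ι → ℝ => exp (-V ω)))
    (hV2 : ∀ z, Integrable (fun ω : ι → ℝ => ω z ^ 2 * exp (-V ω)))
    (hF : ∀ z ω s t, |F (update ω z s) - F (update ω z t)| ≤ a z * |s - t|) : Integrable (fun ω => F ω * exp (-V ω)) := by
  haveI : IsProbabilityMeasure ((volume : Measure (ι → ℝ)).tilted fun ω => -V ω) := isProbabilityMeasure_tilted hV0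
  have h := SupCoordinateLipschitzClass.integrable hF (memLp_coord_tilted hV0 hV2)
  rw [integrable_tilted_iff hV0] at h
  refine h.congr (ae_of_all _ fun ω => ?_)
  simp only [smul_eq_mul]; ring

/-- **The product of two class members is integrable against `ρ`** ((441) under the Gibbs law, transferred). [folklore] -/
theorem integrable_class_prod_mul_exp (hV0 : Integrable (fun ω : ι → ℝ => exp (-V ω)))
    (hV2 : ∀ z, Integrable (fun ω : ι → ℝ => ω z ^ 2 * exp (-V ω)))
    (hF : ∀ z ω s t, |F (update ω z s) - F (update ω z t)| ≤ a z * |s - t|)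
    (hG : ∀ z ω s t, |G (update ω z s) - G (update ω z t)| ≤ b z * |s - t|) :
    Integrable (fun ω => F ω * G ω * exp (-V ω)) := by
  haveI : IsProbabilityMeasure ((volume : Measure (ι → ℝ)).tilted fun ω => -V ω) := isProbabilityMeasure_tilted hV0
  have h := SupCoordinateLipschitzClass.integrable_mul hF hG (memLp_coord_tilted hV0 hV2)
  rw [integrable_tilted_iff hV0] at h
  refine h.congr (ae_of_all _ fun ω => ?_)
  simp only [smul_eq_mul]; ring

omit [Fintype ι] in
/-- Along a line, the product of two class members is integrable against the line weight. [folklore] -/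
theorem line_prod_integrable (hV : ∀ x ω, HasDerivAt (fun s => V (update ω x s)) (V₁ x ω) (ω x))
    (hfloor : ∀ x ω s t, c x * (s - t) ^ 2 ≤ (V₁ x (update ω x s) - V₁ x (update ω x t)) * (s - t)) (hc : ∀ x, 0 < c x)
    (hF : ∀ z ω s t, |F (update ω z s) - F (update ω z t)| ≤ a z * |s - t|)
    (hG : ∀ z ω s t, |G (update ω z s) - G (update ω z t)| ≤ b z * |s - t|) (x : ι) (ω : ι → ℝ) :
    Integrable (fun s => F (update ω x s) * G (update ω x s) * exp (-V (update ω x s))) := by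
  have hw := line_hasDerivAt hV x ω
  refine integrable_of_le_exp hw (hfloor x ω) (hc x) ((lip_continuous (hF x ω)).mul (lip_continuous (hG x ω))).measurable
    (M := (|F (update ω x 0)| + a x) * (|G (update ω x 0)| + b x)) (K := 2) fun s => ?_
  rw [abs_mul, two_mul, exp_add]
  have h1 := lip_bound (h := fun s => F (update ω x s)) (hF x ω) s
  have h2 := lip_bound (h := fun s => G (update ω x s)) (hG x ω) s
  calc |F (update ω x s)| * |G (update ω x s)| ≤ ((|F (update ω x 0)| + a x) * exp |s|) * ((|G (update ω x 0)| + b x) * exp |s|) :=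
        mul_le_mul h1 h2 (abs_nonneg _) ((abs_nonneg _).trans h1)
    _ = (|F (update ω x 0)| + a x) * (|G (update ω x 0)| + b x) * (exp |s| * exp |s|) := by ring

/-! ## §3. (P2) Invariance -/

/-- **(P2) THE RESAMPLING OPERATOR IS `ρ`-INVARIANT**: `∫(P_xF)e^{−V} = ∫Fe^{−V}`. [folklore] -/
theorem resample_integral
    (hP : ∀ x F ω, P x F ω = (∫ s, F (update ω x s) * exp (-V (update ω x s))) / ∫ s, exp (-V (update ω x s)))
    (hV : ∀ x ω, HasDerivAt (fun s => V (update ω x s)) (V₁ x ω) (ω x))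
    (hfloor : ∀ x ω s t, c x * (s - t) ^ 2 ≤ (V₁ x (update ω x s) - V₁ x (update ω x t)) * (s - t)) (hc : ∀ x, 0 < c x)
    (hceil : ∀ x ω s t, |V₁ x (update ω x s) - V₁ x (update ω x t)| ≤ Cw * |s - t|)
    (hcross : ∀ x z, z ≠ x → ∀ ω s t, |V₁ x (update ω z s) - V₁ x (update ω z t)| ≤ J x z * |s - t|) (hVc : Continuous V)
    (hV0 : Integrable (fun ω : ι → ℝ => exp (-V ω))) (hV2 : ∀ z, Integrable (fun ω : ι → ℝ => ω z ^ 2 * exp (-V ω))) (x : ι)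
    (hF : ∀ z ω s t, |F (update ω z s) - F (update ω z t)| ≤ a z * |s - t|) :
    ∫ ω, P x F ω * exp (-V ω) = ∫ ω, F ω * exp (-V ω) := by
  have hPF := resample_lipVec hP hV hfloor hc hceil hcross x F a hF
  have hρc : Continuous fun ω : ι → ℝ => exp (-V ω) := continuous_exp.comp hVc.neg
  refine integral_eq_of_line_integral_eq x (((SupCoordinateLipschitzClass.continuous hPF).mul hρc).measurable)
    (((SupCoordinateLipschitzClass.continuous hF).mul hρc).measurable) (integrable_class_mul_exp hV0 hV2 hPF)
    (integrable_class_mul_exp hV0 hV2 hF) (fun ω => ?_) (fun ω => (line_obs_integrable hV hfloor hc hF x ω).1) fun ω => ?_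
  · -- along the line `P_xF` is the constant `P_xF(ω)`
    have e : (fun s => P x F (update ω x s) * exp (-V (update ω x s))) = fun s => P x F ω * exp (-V (update ω x s)) := by
      funext s; rw [resample_update_self hP]
    rw [e]
    exact (line_obs_integrable hV hfloor hc hF x ω).2.1.const_mul _
  · obtain ⟨_, _, hZ⟩ := line_obs_integrable hV hfloor hc hF x ω
    have e : (fun s => P x F (update ω x s) * exp (-V (update ω x s))) = fun s => P x F ω * exp (-V (update ω x s)) := by
      funext s; rw [resample_update_self hP]
    rw [e, integral_const_mul, hP]
    field_simp

/-! ## §4. (P3) The one-step covariance loss -/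

omit [Fintype ι] in
/-- **The conditional covariance along the `x`-line is at most `a_xb_x∕c_x`** ((443) on the line). [folklore] -/
theorem cond_cov_abs_le (hV : ∀ x ω, HasDerivAt (fun s => V (update ω x s)) (V₁ x ω) (ω x))
    (hfloor : ∀ x ω s t, c x * (s - t) ^ 2 ≤ (V₁ x (update ω x s) - V₁ x (update ω x t)) * (s - t)) (hc : ∀ x, 0 < c x)
    (hceil : ∀ x ω s t, |V₁ x (update ω x s) - V₁ x (update ω x t)| ≤ Cw * |s - t|)
    (hF : ∀ z ω s t, |F (update ω z s) - F (update ω z t)| ≤ a z * |s - t|)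
    (hG : ∀ z ω s t, |G (update ω z s) - G (update ω z t)| ≤ b z * |s - t|) (x : ι) (ω : ι → ℝ) :
    |(∫ s, F (update ω x s) * G (update ω x s) * exp (-V (update ω x s))) / (∫ s, exp (-V (update ω x s))) -
        ((∫ s, F (update ω x s) * exp (-V (update ω x s))) / (∫ s, exp (-V (update ω x s)))) *
          ((∫ s, G (update ω x s) * exp (-V (update ω x s))) / (∫ s, exp (-V (update ω x s))))| ≤ a x * b x / c x := by
  have hw := line_hasDerivAt hV x ω
  obtain ⟨_, _, hZ⟩ := line_obs_integrable hV hfloor hc hF x ω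
  have h := cov_raw_abs_le_floor hw (hfloor x ω) (hc x) (hceil x ω) (hF x ω) (hG x ω)
  set Z := ∫ s, exp (-V (update ω x s)) with hZdef
  have e : (∫ s, F (update ω x s) * G (update ω x s) * exp (-V (update ω x s))) / Z -
      ((∫ s, F (update ω x s) * exp (-V (update ω x s))) / Z) * ((∫ s, G (update ω x s) * exp (-V (update ω x s))) / Z) =
      ((∫ s, F (update ω x s) * G (update ω x s) * exp (-V (update ω x s))) * Z -
        (∫ s, F (update ω x s) * exp (-V (update ω x s))) * (∫ s, G (update ω x s) * exp (-V (update ω x s)))) / Z ^ 2 := by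
    field_simp
  have hcx : c x ≠ 0 := (hc x).ne'
  rw [e, abs_div, abs_of_pos (pow_pos hZ 2), div_le_iff₀ (pow_pos hZ 2)]
  calc |(∫ s, F (update ω x s) * G (update ω x s) * exp (-V (update ω x s))) * Z -
        (∫ s, F (update ω x s) * exp (-V (update ω x s))) * (∫ s, G (update ω x s) * exp (-V (update ω x s)))|
      ≤ a x * b x * (Z ^ 2 / c x) := h
    _ = a x * b x / c x * Z ^ 2 := by field_simp

/-- **(P3) THE ONE-STEP COVARIANCE LOSS**: `|∫FGρ − ∫(P_xF)(P_xG)ρ| ≤ (a_xb_x∕c_x)·∫ρ`. [folklore] -/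
theorem resample_cov_step
    (hP : ∀ x F ω, P x F ω = (∫ s, F (update ω x s) * exp (-V (update ω x s))) / ∫ s, exp (-V (update ω x s)))
    (hV : ∀ x ω, HasDerivAt (fun s => V (update ω x s)) (V₁ x ω) (ω x))
    (hfloor : ∀ x ω s t, c x * (s - t) ^ 2 ≤ (V₁ x (update ω x s) - V₁ x (update ω x t)) * (s - t)) (hc : ∀ x, 0 < c x)
    (hceil : ∀ x ω s t, |V₁ x (update ω x s) - V₁ x (update ω x t)| ≤ Cw * |s - t|)
    (hcross : ∀ x z, z ≠ x → ∀ ω s t, |V₁ x (update ω z s) - V₁ x (update ω z t)| ≤ J x z * |s - t|) (hVc : Continuous V)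
    (hV0 : Integrable (fun ω : ι → ℝ => exp (-V ω))) (hV2 : ∀ z, Integrable (fun ω : ι → ℝ => ω z ^ 2 * exp (-V ω))) (x : ι)
    (hF : ∀ z ω s t, |F (update ω z s) - F (update ω z t)| ≤ a z * |s - t|)
    (hG : ∀ z ω s t, |G (update ω z s) - G (update ω z t)| ≤ b z * |s - t|) :
    |(∫ ω, F ω * G ω * exp (-V ω)) - ∫ ω, P x F ω * P x G ω * exp (-V ω)| ≤ a x * b x / c x * ∫ ω, exp (-V ω) := by
  have hPF := resample_lipVec hP hV hfloor hc hceil hcross x F a hF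
  have hPG := resample_lipVec hP hV hfloor hc hceil hcross x G b hG
  have hρc : Continuous fun ω : ι → ℝ => exp (-V ω) := continuous_exp.comp hVc.neg
  have hFc := SupCoordinateLipschitzClass.continuous hF
  have hGc := SupCoordinateLipschitzClass.continuous hG
  have hPFc := SupCoordinateLipschitzClass.continuous hPF
  have hPGc := SupCoordinateLipschitzClass.continuous hPG
  -- the conditional covariance `m(ω)` (constant along the `x`-line)
  set m : (ι → ℝ) → ℝ := fun ω => (∫ s, F (update ω x s) * G (update ω x s) * exp (-V (update ω x s))) / (∫ s, exp (-V (update ω x s))) -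
    P x F ω * P x G ω with hm
  have hmx : ∀ ω t, m (update ω x t) = m ω := by
    intro ω t; simp only [hm, update_idem, resample_update_self hP]
  have hmb : ∀ ω, |m ω| ≤ a x * b x / c x := by
    intro ω; simp only [hm, hP]; exact cond_cov_abs_le hV hfloor hc hceil hF hG x ω
  have hmm : Measurable m := by
    have h1 : Measurable fun ω : ι → ℝ => ∫ s, F (update ω x s) * G (update ω x s) * exp (-V (update ω x s)) :=
      measurable_line_integral x ((hFc.mul hGc).mul hρc)
    have h2 : Measurable fun ω : ι → ℝ => ∫ s, exp (-V (update ω x s)) := measurable_line_integral x hρc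
    exact (h1.div h2).sub (hPFc.measurable.mul hPGc.measurable)
  have hmρ : Integrable (fun ω => m ω * exp (-V ω)) := by
    refine (hV0.const_mul (a x * b x / c x)).mono' (hmm.mul hρc.measurable).aestronglyMeasurable (ae_of_all _ fun ω => ?_)
    rw [norm_mul, Real.norm_eq_abs, Real.norm_of_nonneg (exp_pos _).le]
    exact mul_le_mul_of_nonneg_right (hmb ω) (exp_pos _).le
  -- the integrals of `FGρ − (P_xF)(P_xG)ρ` and `mρ` agree (transfer)
  have hint1 := integrable_class_prod_mul_exp hV0 hV2 hF hG
  have hint2 := integrable_class_prod_mul_exp hV0 hV2 hPF hPG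
  have htr : ∫ ω, (F ω * G ω * exp (-V ω) - P x F ω * P x G ω * exp (-V ω)) = ∫ ω, m ω * exp (-V ω) := by
    refine integral_eq_of_line_integral_eq x ((((hFc.mul hGc).mul hρc).sub ((hPFc.mul hPGc).mul hρc)).measurable)
      (hmm.mul hρc.measurable) (hint1.sub hint2) hmρ (fun ω => ?_) (fun ω => ?_) fun ω => ?_
    · have e : (fun s => F (update ω x s) * G (update ω x s) * exp (-V (update ω x s)) -
          P x F (update ω x s) * P x G (update ω x s) * exp (-V (update ω x s))) =
          fun s => F (update ω x s) * G (update ω x s) * exp (-V (update ω x s)) - P x F ω * P x G ω * exp (-V (update ω x s)) := by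
        funext s; rw [resample_update_self hP, resample_update_self hP]
      rw [e]
      exact (line_prod_integrable hV hfloor hc hF hG x ω).sub ((line_obs_integrable hV hfloor hc hF x ω).2.1.const_mul _)
    · have e : (fun s => m (update ω x s) * exp (-V (update ω x s))) = fun s => m ω * exp (-V (update ω x s)) := by
        funext s; rw [hmx]
      rw [e]
      exact (line_obs_integrable hV hfloor hc hF x ω).2.1.const_mul _
    · obtain ⟨_, hI0, hZ⟩ := line_obs_integrable hV hfloor hc hF x ω
      have e1 : (fun s => F (update ω x s) * G (update ω x s) * exp (-V (update ω x s)) -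
          P x F (update ω x s) * P x G (update ω x s) * exp (-V (update ω x s))) =
          fun s => F (update ω x s) * G (update ω x s) * exp (-V (update ω x s)) - P x F ω * P x G ω * exp (-V (update ω x s)) := by
        funext s; rw [resample_update_self hP, resample_update_self hP]
      have e2 : (fun s => m (update ω x s) * exp (-V (update ω x s))) = fun s => m ω * exp (-V (update ω x s)) := by
        funext s; rw [hmx]
      rw [e1, e2, integral_sub (line_prod_integrable hV hfloor hc hF hG x ω) (hI0.const_mul _), integral_const_mul, integral_const_mul, hm]
      simp only
      field_simp
  have hsub0 : (∫ ω, F ω * G ω * exp (-V ω)) - ∫ ω, P x F ω * P x G ω * exp (-V ω) =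
      ∫ ω, (F ω * G ω * exp (-V ω) - P x F ω * P x G ω * exp (-V ω)) := (integral_sub hint1 hint2).symm
  rw [hsub0, htr]
  calc |∫ ω, m ω * exp (-V ω)| ≤ ∫ ω, |m ω * exp (-V ω)| := abs_integral_le_integral_abs
    _ ≤ ∫ ω, a x * b x / c x * exp (-V ω) := by
        have hpt : ∀ ω : ι → ℝ, |m ω * exp (-V ω)| ≤ a x * b x / c x * exp (-V ω) := fun ω => by
          rw [abs_mul, abs_of_pos (exp_pos _)]; exact mul_le_mul_of_nonneg_right (hmb ω) (exp_pos _).le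
        exact integral_mono_of_nonneg (ae_of_all _ fun ω => abs_nonneg _) (hV0.const_mul _) (ae_of_all _ hpt)
    _ = a x * b x / c x * ∫ ω, exp (-V ω) := integral_const_mul _ _

end Summit.QuantumFields.BalabanUV.T4Continuum.NE7b.SupOneSiteResamplingInvariance

end
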